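import Summits.SmoothPoincare4.SmoothPoincare4.Theses.EntropyRung
import Summits.SmoothPoincare4.SmoothPoincare4.Theorems.EntropyRungSubcylindricalExistenceCapFloor
import Summits.SmoothPoincare4.SmoothPoincare4.Theorems.EntropyRungSubcylindricalExistenceAnnulusModelOnMWeight
import HarnessLib

/-!
# The exact-cone annulus model on `M` (stub `helper_annulusModelOnM`, H-annM, line
`fat-conical-core-avr-logsobolev`, crux `EntropyRung.SubcylindricalExistence`,
item stmt-SmoothPoincare4-10871)

Let `g` be a Riemannian metric (Levi-Civita) on a closed 4-manifold `M` of the summit binder,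
`p : M`, `φ = extChartAt (𝓡 4) p`, `y₀ = φ p`, and suppose `g` is EUCLIDEAN in the chart on the
closed ball `B̄(y₀, r) ⊆ φ.target`. Fix a slope `c' ∈ (0, 1]`, a constant `μ > 0` and radii
`0 < ρ₁ < ρ₂ < r`. HYPOTHESIS (H, the conclusion of `helper_annulusConeFloor`): the Euclidean
exact-cone annulus floor — for every smooth `v` on `ℝ⁴` with `tsupport v` inside an open annulus
`{ρ₁' < ‖z‖ < ρ₂'}` and `∫ (4πτ)⁻² v² Λ'⁴ dz = 1`, `Λ'(z) = c'‖z‖^{−(c'+1)}`, one has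
`3 log c' ≤ ∫ [4τ Λ'⁻² ‖∇v‖² − v² log v² − 4v²] (4πτ)⁻² Λ'⁴ dz`.
CONCLUSION: there is a smooth positive weight `ψ₀` on `M` with
`ψ₀ x = μ c' ‖φ x − y₀‖^{−(c'+1)}` on the closed chart annulus `ρ₁ ≤ ‖φ x − y₀‖ ≤ ρ₂` such that
for every `s > 0` and every smooth `w` supported in the open chart annulus with
`∫ (4πs)⁻² w² ψ₀⁴ dV_g = 1`:
`3 log c' ≤ ∫ [s · 4ψ₀⁻² |∇w|²_g − w² log w² − 4w²] (4πs)⁻² ψ₀⁴ dV_g`.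

Proof. (1) The weight `ψ₀` is `helper_annulusModelOnM_weight` (`AnnulusModelOnM.exists_weight`,
companion file). (2) The clause is transported to `ℝ⁴` exactly as in `CapFloor.capFloor'`: the
integrands vanish off the closed chart ball, where `dV_g` is Lebesgue measure
(`stub_setIntegralFlatChart`) and `|∇w|²_g = ‖∇(w ∘ φ⁻¹)‖²` (`stub_gradSqFlatChart`); the compactly
supported smooth chart extension `V = 𝟙_{target}(w ∘ φ⁻¹)` and its gradient vanish off the
closed annulus, where the formula for `ψ₀` holds; after the translation `z = y − y₀` the support
of `v = V(· + y₀)` lies in the closed annulus `[ρ₁, ρ₂] ⊆ (ρ₁/2, 2ρ₂)`. (3) The constant `μ` is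
scaled out: `(4πs)⁻² μ⁴ = (4π s/μ²)⁻²` and `s (μΛ')⁻² = (s/μ²) Λ'⁻²`
(`AnnulusModelOnM.weight_identity`), so the functional for the weight `μΛ'` at scale `s` is
LITERALLY the functional of (H) for `Λ'` at scale `s/μ²`, and the normalisations agree.
References: Perelman 2002, §3 (the `𝒲`-functional and its scaling); Lee–Parker 1987, §3
(`dV = u⁴ dy` in conformally flat coordinates). [folklore]
-/

noncomputable section

-- the registered namespace `Summit.SmoothPoincare4.SmoothPoincare4.Theorems` repeats a component
set_option linter.dupNamespace false

open scoped Manifold ContDiff Topology RealInnerProductSpace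
open Set Filter MeasureTheory
open Literature.Geometry.Lorentzian Literature.Geometry.Riemannian

namespace Summit.SmoothPoincare4.SmoothPoincare4.Theorems

namespace AnnulusModelOnM

open SphereSideClause

/-! ### The clause on `M` from the Euclidean annulus floor -/

/-- **The annulus clause on `M` (workhorse form).** For `g` Euclidean in the chart at `p` on
`closedBall _ r`, a continuous positive weight `ψ₀` equal to `μ c'‖φ x − φ p‖^{−(c'+1)}` on the
closed chart annulus `[ρ₁, ρ₂]` (`ρ₂ < r`), and the Euclidean exact-cone annulus floor (H): every
smooth `w` supported in the open chart annulus with `∫ (4πs)⁻² w² ψ₀⁴ dV_g = 1` satisfies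
`3 log c' ≤ ∫ [s·4ψ₀⁻²|∇w|²_g − w² log w² − 4w²](4πs)⁻² ψ₀⁴ dV_g` (transport through the flat
chart, translation, and the dilation `s ↦ s/μ²`). [folklore] -/
theorem annulusClause'
    (H : ∀ c' : ℝ, 0 < c' → c' ≤ 1 → ∀ ρ₁ ρ₂ : ℝ, 0 < ρ₁ → ρ₁ < ρ₂ → ∀ τ : ℝ, 0 < τ →
      ∀ v : EuclideanSpace ℝ (Fin 4) → ℝ, ContDiff ℝ ∞ v →
        tsupport v ⊆ {z | ρ₁ < ‖z‖ ∧ ‖z‖ < ρ₂} →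
        ∫ z, (4 * Real.pi * τ) ^ (-(4 : ℝ) / 2) * (v z) ^ 2 * (c' * ‖z‖ ^ (-(c' + 1))) ^ 4 = 1 →
          3 * Real.log c' ≤
            ∫ z, (4 * τ * ((c' * ‖z‖ ^ (-(c' + 1)))⁻¹ ^ 2 * ‖gradient v z‖ ^ 2)
                - (v z) ^ 2 * Real.log ((v z) ^ 2) - 4 * (v z) ^ 2)
                * ((4 * Real.pi * τ) ^ (-(4 : ℝ) / 2) * (c' * ‖z‖ ^ (-(c' + 1))) ^ 4))
    {M : Type} [TopologicalSpace M] [T2Space M] [SecondCountableTopology M]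
    [ChartedSpace (EuclideanSpace ℝ (Fin 4)) M] [IsManifold (𝓡 4) ∞ M] [CompactSpace M]
    [T3Space M] [MeasurableSpace M] [BorelSpace M]
    (g : PseudoRiemannianMetric (𝓡 4) ∞ (EuclideanSpace ℝ (Fin 4)) (TangentSpace (𝓡 4) : M → Type _))
    [g.HasLeviCivita] (hg : g.IsRiemannian) {p : M} {r : ℝ} {ψ₀ : M → ℝ} {c' μ ρ₁ ρ₂ : ℝ}
    (hball : Metric.closedBall (extChartAt (𝓡 4) p p) r ⊆ (extChartAt (𝓡 4) p).target)
    (hflat : ∀ y ∈ Metric.closedBall (extChartAt (𝓡 4) p p) r, ∀ X W : EuclideanSpace ℝ (Fin 4),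
      g.val ((extChartAt (𝓡 4) p).symm y)
        (mfderiv 𝓘(ℝ, EuclideanSpace ℝ (Fin 4)) (𝓡 4) (extChartAt (𝓡 4) p).symm y X)
        (mfderiv 𝓘(ℝ, EuclideanSpace ℝ (Fin 4)) (𝓡 4) (extChartAt (𝓡 4) p).symm y W) = ⟪X, W⟫)
    (hr : 0 < r) (hc' : 0 < c') (hc'1 : c' ≤ 1) (hμ : 0 < μ) (hρ₁ : 0 < ρ₁) (hρ₁₂ : ρ₁ < ρ₂)
    (hρ₂r : ρ₂ < r) (hψc : Continuous ψ₀) (hψpos : ∀ x, 0 < ψ₀ x)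
    (hψann : ∀ x, x ∈ (extChartAt (𝓡 4) p).source →
      ρ₁ ≤ ‖extChartAt (𝓡 4) p x - extChartAt (𝓡 4) p p‖ →
      ‖extChartAt (𝓡 4) p x - extChartAt (𝓡 4) p p‖ ≤ ρ₂ →
        ψ₀ x = μ * (c' * ‖extChartAt (𝓡 4) p x - extChartAt (𝓡 4) p p‖ ^ (-(c' + 1))))
    {s : ℝ} (hs : 0 < s) {w : M → ℝ} (hw : ContMDiff (𝓡 4) 𝓘(ℝ, ℝ) ∞ w)
    (hwsupp : ∀ x, w x ≠ 0 → x ∈ (extChartAt (𝓡 4) p).source ∧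
      ρ₁ < ‖extChartAt (𝓡 4) p x - extChartAt (𝓡 4) p p‖ ∧
      ‖extChartAt (𝓡 4) p x - extChartAt (𝓡 4) p p‖ < ρ₂)
    (hnorm : ∫ x, (4 * Real.pi * s) ^ (-(4 : ℝ) / 2) * (w x) ^ 2 * (ψ₀ x) ^ 4
      ∂(riemannianMeasure (g.toContMDiffRiemannianMetric hg)) = 1) :
    3 * Real.log c' ≤
      ∫ x, (s * (4 * ((ψ₀ x)⁻¹ ^ 2 * g.gradSq w x))
          - (w x) ^ 2 * Real.log ((w x) ^ 2) - 4 * (w x) ^ 2)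
          * ((4 * Real.pi * s) ^ (-(4 : ℝ) / 2) * (ψ₀ x) ^ 4)
        ∂(riemannianMeasure (g.toContMDiffRiemannianMetric hg)) := by
  have hS0 := stub_gradSqFlatChart M g p
  have hS0b := stub_setIntegralFlatChart M g hg p r hr hball hflat
  /- positivity and continuity -/
  have hψne : ∀ x, ψ₀ x ≠ 0 := fun x ↦ (hψpos x).ne'
  have hwc : Continuous w := hw.continuous
  have hQc : Continuous (g.gradSq w) := (contMDiff_gradSq g hw).continuous
  have hρ₂ : 0 < ρ₂ := hρ₁.trans hρ₁₂
  /- the closed chart annulus `A`: inside the open ball, compact -/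
  obtain ⟨A, hA⟩ : ∃ A : Set (EuclideanSpace ℝ (Fin 4)),
      A = {y | ρ₁ ≤ ‖y - extChartAt (𝓡 4) p p‖ ∧ ‖y - extChartAt (𝓡 4) p p‖ ≤ ρ₂} := ⟨_, rfl⟩
  have hAball : A ⊆ Metric.ball (extChartAt (𝓡 4) p p) r := fun y hy ↦ by
    rw [hA] at hy
    rw [Metric.mem_ball, dist_eq_norm]
    exact hy.2.trans_lt hρ₂r
  have hAt : A ⊆ (extChartAt (𝓡 4) p).target :=
    fun y hy ↦ hball (Metric.ball_subset_closedBall (hAball hy))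
  have hAcpt : IsCompact A := by
    refine (isCompact_closedBall (extChartAt (𝓡 4) p p) r).of_isClosed_subset ?_
      fun y hy ↦ Metric.ball_subset_closedBall (hAball hy)
    have hA' : A = (fun y : EuclideanSpace ℝ (Fin 4) ↦ ‖y - extChartAt (𝓡 4) p p‖) ⁻¹'
        Icc ρ₁ ρ₂ := by
      rw [hA]; rfl
    rw [hA']
    exact isClosed_Icc.preimage (by fun_prop)
  /- the support of `w` -/
  have htsupp : tsupport w ⊆ (extChartAt (𝓡 4) p).symm '' A := by
    refine closure_minimal ?_ ((hAcpt.image_of_continuousOn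
      ((continuousOn_extChartAt_symm p).mono hAt)).isClosed)
    intro x hx
    obtain ⟨hxs, h1, h2⟩ := hwsupp x hx
    exact ⟨extChartAt (𝓡 4) p x, by rw [hA]; exact ⟨h1.le, h2.le⟩,
      (extChartAt (𝓡 4) p).left_inv hxs⟩
  have hcap : ∀ x ∈ tsupport w, x ∈ (extChartAt (𝓡 4) p).source ∧ extChartAt (𝓡 4) p x ∈ A := by
    intro x hx
    obtain ⟨y, hy, rfl⟩ := htsupp hx
    refine ⟨(extChartAt (𝓡 4) p).map_target (hAt hy), ?_⟩
    rw [(extChartAt (𝓡 4) p).right_inv (hAt hy)]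
    exact hy
  have hsupp : tsupport w ⊆ {x | x ∈ (extChartAt (𝓡 4) p).source ∧
      extChartAt (𝓡 4) p x ∈ Metric.ball (extChartAt (𝓡 4) p p) r} :=
    fun x hx ↦ ⟨(hcap x hx).1, hAball (hcap x hx).2⟩
  have hsub : tsupport w ⊆ (extChartAt (𝓡 4) p).source := fun x hx ↦ (hsupp hx).1
  have hv0 : ∀ x, x ∉ {x | x ∈ (extChartAt (𝓡 4) p).source ∧
      extChartAt (𝓡 4) p x ∈ Metric.closedBall (extChartAt (𝓡 4) p p) r} →
      w x = 0 ∧ g.gradSq w x = 0 := by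
    intro x hx
    have hx' : x ∉ tsupport w := fun h ↦
      hx ⟨(hsupp h).1, Metric.ball_subset_closedBall (hsupp h).2⟩
    refine ⟨image_eq_zero_of_notMem_tsupport hx', ?_⟩
    have hev : w =ᶠ[𝓝 x] fun _ ↦ (0 : ℝ) := notMem_tsupport_iff_eventuallyEq.1 hx'
    rw [show g.gradSq w x = g.gradSq (fun _ : M ↦ (0 : ℝ)) x by
      simp only [PseudoRiemannianMetric.gradSq, mvfderiv_congr_of_eventuallyEq hev]]
    exact g.gradSq_const 0 x
  /- the chart extension of `w` -/
  have hVcd := chartExt_contDiff p hw hsub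
  have hVapply : ∀ y ∈ Metric.closedBall (extChartAt (𝓡 4) p p) r,
      (extChartAt (𝓡 4) p).target.indicator (w ∘ (extChartAt (𝓡 4) p).symm) y =
        w ((extChartAt (𝓡 4) p).symm y) := fun y hy ↦ indicator_of_mem (hball hy) _
  have hVgrad : ∀ y ∈ Metric.closedBall (extChartAt (𝓡 4) p p) r,
      g.gradSq w ((extChartAt (𝓡 4) p).symm y) =
        ‖gradient ((extChartAt (𝓡 4) p).target.indicator (w ∘ (extChartAt (𝓡 4) p).symm))
          y‖ ^ 2 := by
    intro y hy
    rw [hS0 y (hball hy) (hflat y hy) w (hw.mdifferentiableAt (by simp)),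
      (chartExt_eventuallyEq p w (hball hy)).gradient_eq]
  have hVzero : ∀ y : EuclideanSpace ℝ (Fin 4), y ∉ A →
      (extChartAt (𝓡 4) p).target.indicator (w ∘ (extChartAt (𝓡 4) p).symm) y = 0 ∧
      gradient ((extChartAt (𝓡 4) p).target.indicator (w ∘ (extChartAt (𝓡 4) p).symm)) y = 0 := by
    intro y hy
    refine chartExt_eq_zero p hsub ?_
    rintro ⟨x, hx, rfl⟩
    exact hy (hcap x hx).2
  /- `ψ₀` in the chart -/
  have hψchart : ∀ y ∈ A, ψ₀ ((extChartAt (𝓡 4) p).symm y) =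
      μ * (c' * ‖y - extChartAt (𝓡 4) p p‖ ^ (-(c' + 1))) := by
    intro y hy
    have h := hψann ((extChartAt (𝓡 4) p).symm y) ((extChartAt (𝓡 4) p).map_target (hAt hy))
    rw [(extChartAt (𝓡 4) p).right_inv (hAt hy)] at h
    rw [hA] at hy
    exact h hy.1 hy.2
  clear hS0 hflat hAcpt htsupp hcap hψann
  /- abstract the chart and the extension -/
  generalize hV : (extChartAt (𝓡 4) p).target.indicator (w ∘ (extChartAt (𝓡 4) p).symm) = V at *
  generalize hφ : extChartAt (𝓡 4) p = φ at *
  have hτ : 0 < s / μ ^ 2 := by positivity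
  /- Step 1: the normalisation transported to `ℝ⁴` -/
  have hnormE : ∫ z : EuclideanSpace ℝ (Fin 4), (4 * Real.pi * (s / μ ^ 2)) ^ (-(4 : ℝ) / 2) *
      (V (z + φ p)) ^ 2 * (c' * ‖z‖ ^ (-(c' + 1))) ^ 4 = 1 := by
    have hT := transfer (F := fun x ↦ (4 * Real.pi * s) ^ (-(4 : ℝ) / 2) * (w x) ^ 2 * (ψ₀ x) ^ 4)
      (FE := fun y ↦ (4 * Real.pi * s) ^ (-(4 : ℝ) / 2) * (V y) ^ 2 *
        (μ * (c' * ‖y - φ p‖ ^ (-(c' + 1)))) ^ 4) hS0b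
      (by fun_prop) (fun x hx ↦ by simp [(hv0 x hx).1])
      (fun y hy ↦ by
        by_cases hyA : y ∈ A
        · simp only [hVapply y hy, hψchart y hyA]
        · have h1 := (hVzero y hyA).1
          have h2 : w (φ.symm y) = 0 := by rw [← hVapply y hy, h1]
          simp [h1, h2])
      (fun y hy ↦ by
        simp [(hVzero y fun h ↦ hy (Metric.ball_subset_closedBall (hAball h))).1])
    refine (integral_congr_ae (Eventually.of_forall fun z ↦ ?_)).trans (hT.symm.trans hnorm)
    simp only [add_sub_cancel_right]
    have hwI := weight_identity₀ hμ hs (c' * ‖z‖ ^ (-(c' + 1)))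
    calc (4 * Real.pi * (s / μ ^ 2)) ^ (-(4 : ℝ) / 2) * (V (z + φ p)) ^ 2 *
          (c' * ‖z‖ ^ (-(c' + 1))) ^ 4
        = (V (z + φ p)) ^ 2 * ((4 * Real.pi * (s / μ ^ 2)) ^ (-(4 : ℝ) / 2) *
          (c' * ‖z‖ ^ (-(c' + 1))) ^ 4) := by ring
      _ = (V (z + φ p)) ^ 2 * ((4 * Real.pi * s) ^ (-(4 : ℝ) / 2) *
          (μ * (c' * ‖z‖ ^ (-(c' + 1)))) ^ 4) := by rw [hwI]
      _ = _ := by ring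
  /- Step 2: the annulus floor on `ℝ⁴` at scale `s/μ²` for the translated extension -/
  have hVtc : ContDiff ℝ ∞ fun z : EuclideanSpace ℝ (Fin 4) ↦ V (z + φ p) :=
    hVcd.comp (contDiff_id.add contDiff_const)
  have hVts : tsupport (fun z : EuclideanSpace ℝ (Fin 4) ↦ V (z + φ p)) ⊆
      {z | ρ₁ / 2 < ‖z‖ ∧ ‖z‖ < 2 * ρ₂} := by
    refine (closure_minimal (t := {z : EuclideanSpace ℝ (Fin 4) | ρ₁ ≤ ‖z‖ ∧ ‖z‖ ≤ ρ₂}) ?_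
      ((isClosed_le continuous_const continuous_norm).inter
        (isClosed_le continuous_norm continuous_const))).trans ?_
    · intro z hz
      by_contra h
      refine hz (hVzero (z + φ p) fun h' ↦ h ?_).1
      rw [hA] at h'
      simpa only [mem_setOf_eq, add_sub_cancel_right] using h'
    · intro z hz
      exact ⟨by linarith [hz.1], by linarith [hz.2]⟩
  have hS1 := H c' hc' hc'1 (ρ₁ / 2) (2 * ρ₂) (by positivity) (by linarith) (s / μ ^ 2) hτ
    (fun z ↦ V (z + φ p)) hVtc hVts hnormE
  /- Step 3: the functional on `M` equals the (H) functional at scale `s/μ²` -/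
  have hΦ'c : Continuous fun x ↦ (s * (4 * ((ψ₀ x)⁻¹ ^ 2 * g.gradSq w x))
      - w x ^ 2 * Real.log (w x ^ 2) - 4 * w x ^ 2) *
      ((4 * Real.pi * s) ^ (-(4 : ℝ) / 2) * ψ₀ x ^ 4) := by
    have hlog : Continuous fun x ↦ w x ^ 2 * Real.log (w x ^ 2) :=
      Real.continuous_mul_log.comp (hwc.pow 2)
    have hinv : Continuous fun x ↦ (ψ₀ x)⁻¹ := hψc.inv₀ hψne
    exact (((continuous_const.mul (continuous_const.mul ((hinv.pow 2).mul hQc))).sub hlog).sub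
      (continuous_const.mul (hwc.pow 2))).mul (continuous_const.mul (hψc.pow 4))
  have hT2 := transfer
    (F := fun x ↦ (s * (4 * ((ψ₀ x)⁻¹ ^ 2 * g.gradSq w x))
      - w x ^ 2 * Real.log (w x ^ 2) - 4 * w x ^ 2) *
      ((4 * Real.pi * s) ^ (-(4 : ℝ) / 2) * ψ₀ x ^ 4))
    (FE := fun y ↦ (s * (4 * ((μ * (c' * ‖y - φ p‖ ^ (-(c' + 1))))⁻¹ ^ 2 * ‖gradient V y‖ ^ 2))
      - V y ^ 2 * Real.log (V y ^ 2) - 4 * V y ^ 2) *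
        ((4 * Real.pi * s) ^ (-(4 : ℝ) / 2) * (μ * (c' * ‖y - φ p‖ ^ (-(c' + 1)))) ^ 4))
    hS0b hΦ'c
    (fun x hx ↦ by simp [(hv0 x hx).1, (hv0 x hx).2])
    (fun y hy ↦ by
      by_cases hyA : y ∈ A
      · simp only [hVapply y hy, hψchart y hyA, hVgrad y hy]
      · obtain ⟨h1, h2⟩ := hVzero y hyA
        have h3 : w (φ.symm y) = 0 := by rw [← hVapply y hy, h1]
        have h4 : g.gradSq w (φ.symm y) = 0 := by
          rw [hVgrad y hy, h2, norm_zero, zero_pow two_ne_zero]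
        simp [h1, h2, h3, h4])
    (fun y hy ↦ by
      obtain ⟨h1, h2⟩ := hVzero y fun h ↦ hy (Metric.ball_subset_closedBall (hAball h))
      simp [h1, h2])
  rw [hT2]
  refine hS1.trans_eq (integral_congr_ae (Eventually.of_forall fun z ↦ ?_))
  simp only [gradient_comp_add_right V (φ p) z, add_sub_cancel_right]
  exact weight_identity hμ hs _ _ _ _

end AnnulusModelOnM

open AnnulusModelOnM in
/-- **Stub H-annM of line `fat-conical-core-avr-logsobolev` (the exact-cone annulus model on
`M`).** From the Euclidean exact-cone annulus floor (conclusion of `helper_annulusConeFloor`,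
taken as hypothesis): for `g` Euclidean in the chart at `p` on `closedBall _ r`, a slope
`c' ∈ (0,1]`, a constant `μ > 0` and radii `0 < ρ₁ < ρ₂ < r`, there is a smooth positive weight
`ψ₀` on `M` equal to `μ c'ρ^{−(c'+1)}` on the closed chart annulus `ρ₁ ≤ ρ ≤ ρ₂`
(`helper_annulusModelOnM_weight`), whose R-free weighted `𝒲`-clause holds at level `3 log c'` at every scale for
test functions supported in the open annulus (`annulusClause'`: transport through the flat
chart, translation, dilation `s ↦ s/μ²`). Perelman 2002 §3; Lee–Parker 1987 §3. [folklore] -/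
theorem helper_annulusModelOnM :
    (∀ c' : ℝ, 0 < c' → c' ≤ 1 → ∀ ρ₁ ρ₂ : ℝ, 0 < ρ₁ → ρ₁ < ρ₂ → ∀ τ : ℝ, 0 < τ →
      ∀ v : EuclideanSpace ℝ (Fin 4) → ℝ, ContDiff ℝ ∞ v →
        tsupport v ⊆ {z | ρ₁ < ‖z‖ ∧ ‖z‖ < ρ₂} →
        ∫ z, (4 * Real.pi * τ) ^ (-(4 : ℝ) / 2) * (v z) ^ 2 * (c' * ‖z‖ ^ (-(c' + 1))) ^ 4 = 1 →
          3 * Real.log c' ≤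
            ∫ z, (4 * τ * ((c' * ‖z‖ ^ (-(c' + 1)))⁻¹ ^ 2 * ‖gradient v z‖ ^ 2)
                - (v z) ^ 2 * Real.log ((v z) ^ 2) - 4 * (v z) ^ 2)
                * ((4 * Real.pi * τ) ^ (-(4 : ℝ) / 2) * (c' * ‖z‖ ^ (-(c' + 1))) ^ 4)) →
    ∀ (M : Type) [TopologicalSpace M] [T2Space M] [SecondCountableTopology M]
      [ChartedSpace (EuclideanSpace ℝ (Fin 4)) M] [IsManifold (𝓡 4) ∞ M] [CompactSpace M]
      [T3Space M] [MeasurableSpace M] [BorelSpace M]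
      (g : PseudoRiemannianMetric (𝓡 4) ∞ (EuclideanSpace ℝ (Fin 4)) (TangentSpace (𝓡 4) : M → Type _))
      [g.HasLeviCivita] (hg : g.IsRiemannian) (p : M) (r : ℝ),
      (Metric.closedBall (extChartAt (𝓡 4) p p) r ⊆ (extChartAt (𝓡 4) p).target ∧
        ∀ y ∈ Metric.closedBall (extChartAt (𝓡 4) p p) r, ∀ X W : EuclideanSpace ℝ (Fin 4),
          g.val ((extChartAt (𝓡 4) p).symm y)
            (mfderiv 𝓘(ℝ, EuclideanSpace ℝ (Fin 4)) (𝓡 4) (extChartAt (𝓡 4) p).symm y X)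
            (mfderiv 𝓘(ℝ, EuclideanSpace ℝ (Fin 4)) (𝓡 4) (extChartAt (𝓡 4) p).symm y W) = ⟪X, W⟫) →
      0 < r → ∀ c' : ℝ, 0 < c' → c' ≤ 1 → ∀ μ ρ₁ ρ₂ : ℝ, 0 < μ → 0 < ρ₁ → ρ₁ < ρ₂ → ρ₂ < r →
      ∃ ψ₀ : M → ℝ, ContMDiff (𝓡 4) 𝓘(ℝ, ℝ) ∞ ψ₀ ∧ (∀ x, 0 < ψ₀ x) ∧
        (∀ x, x ∈ (extChartAt (𝓡 4) p).source →
          ρ₁ ≤ ‖extChartAt (𝓡 4) p x - extChartAt (𝓡 4) p p‖ →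
          ‖extChartAt (𝓡 4) p x - extChartAt (𝓡 4) p p‖ ≤ ρ₂ →
            ψ₀ x = μ * (c' * ‖extChartAt (𝓡 4) p x - extChartAt (𝓡 4) p p‖ ^ (-(c' + 1)))) ∧
        ∀ s : ℝ, 0 < s → ∀ w : M → ℝ, ContMDiff (𝓡 4) 𝓘(ℝ, ℝ) ∞ w →
          (∀ x, w x ≠ 0 → x ∈ (extChartAt (𝓡 4) p).source ∧
            ρ₁ < ‖extChartAt (𝓡 4) p x - extChartAt (𝓡 4) p p‖ ∧
            ‖extChartAt (𝓡 4) p x - extChartAt (𝓡 4) p p‖ < ρ₂) →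
          ∫ x, (4 * Real.pi * s) ^ (-(4 : ℝ) / 2) * (w x) ^ 2 * (ψ₀ x) ^ 4
              ∂(riemannianMeasure (g.toContMDiffRiemannianMetric hg)) = 1 →
            3 * Real.log c' ≤
              ∫ x, (s * (4 * ((ψ₀ x)⁻¹ ^ 2 * g.gradSq w x))
                  - (w x) ^ 2 * Real.log ((w x) ^ 2) - 4 * (w x) ^ 2)
                  * ((4 * Real.pi * s) ^ (-(4 : ℝ) / 2) * (ψ₀ x) ^ 4)
                ∂(riemannianMeasure (g.toContMDiffRiemannianMetric hg)) := by
  intro H M _ _ _ _ _ _ _ _ _ g _ hg p r hgauge hr c' hc' hc'1 μ ρ₁ ρ₂ hμ hρ₁ hρ₁₂ hρ₂r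
  obtain ⟨ψ₀, hψs, hψpos, hψann⟩ :=
    exists_weight (M := M) (c' := c') (μ := μ) hgauge.1 hr hc' hμ hρ₁ hρ₁₂ hρ₂r
  exact ⟨ψ₀, hψs, hψpos, hψann, fun s hs w hw hwsupp hnorm ↦
    annulusClause' H g hg hgauge.1 hgauge.2 hr hc' hc'1 hμ hρ₁ hρ₁₂ hρ₂r hψs.continuous hψpos hψann
      hs hw hwsupp hnorm⟩

end Summit.SmoothPoincare4.SmoothPoincare4.Theorems

end
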